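import Mathlib
import Summits.NavierStokesRegularity.NavierStokesRegularity.Theses.RobustBlowupPortability
import HarnessLib

/-!
# `RobustBlowupPortability.Assembly` — the route's assembly (item stmt-NavierStokesRegularity-2929;
  pure logic)

**Statement.** `RobustTorusScenario → TorusPortabilityLemma → LocalSmoothingNearInitialTime →
ClayUniqueness → ¬NavierStokesRegularity`.

PROOF. The route file `Theses/RobustBlowupPortability.lean` carries the planner-authored,
kernel-checked deciding theorem `Theses.RobustBlowupPortability.closes`, whose hypotheses are
exactly the route's items and whose conclusion is the registered leaf; the assembly item is that
implication written as ONE proposition, so it is closed by applying `closes` to the hypotheses.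

HONEST FRAMING: glue between the route's own statements (about HYPOTHETICAL objects); nothing
here bears on the regularity problem itself.
-/

noncomputable section

set_option linter.dupNamespace false

namespace Summit.NavierStokesRegularity.NavierStokesRegularity.Theorems

open Summit.NavierStokesRegularity.NavierStokesRegularity.Theses.RobustBlowupPortability in
/-- **Item stmt-NavierStokesRegularity-2929** (`RobustBlowupPortability.Assembly`): the route's
chain of items implies its registered leaf, by the route file's deciding theorem `closes`. [this
file] -/
theorem robustBlowupPortability_assembly_proof :
    Summit.NavierStokesRegularity.NavierStokesRegularity.Theses.RobustBlowupPortability.Assembly := by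
  unfold Summit.NavierStokesRegularity.NavierStokesRegularity.Theses.RobustBlowupPortability.Assembly
  intro hS hP hL hU
  exact closes hS hP hL hU

end Summit.NavierStokesRegularity.NavierStokesRegularity.Theorems

end
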